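import Summits.HodgeConjecture.HodgeConjecture.Theorems.Ring2WeilCoverageCMFieldCubicRationalNorms
import Summits.HodgeConjecture.HodgeConjecture.Theorems.Ring2WeilCoverageCMFieldSexticCarriers
import Literature.NumberTheory.QuadraticFields.BinaryQuadraticFormsPrimeRepresentation
import HarnessLib

/-!
# Ring 2 — Weil-type family-coverage census, CM-field rows (X-AB): EVERY RATIONAL ROW of the `ℚ(ζ₉)` table —
# `[q] = [1] ⟺ q = x² + 3y²` (`x, y ∈ ℚ`) in `ℚ(ζ₉)⁺^× / Nm ℚ(ζ₉)^×`, the class of every prime, and the DYADIC row `[2]`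

HONEST FRAMING: research route conditional on HC_CM; not a corollary; Q11.4-sentence-2 already refuted in dim ≥ 3.

Cell `pub-hodge-ring2`, seat `ring2-b03` (gen 59), census `WEIL-FAMILY-COVERAGE.md` «## b03» b03.24 (the `g = 12` rows
`(3,2)`), twin of part X-AA for the second cubic cyclotomic carrier `R = S³ + 6S² + 9S + 3` (`F = realField R = ℚ(ζ₉)⁺`,
`E = cmField R = ℚ(ζ₉)`, `η = ζ₉ − ζ₉⁻¹`, `σ = η²`; parts X-U/X-V). The census table (kit j209882 ×2) has `[3] = [1]`,
`[2]` NON-SPLIT with `T(2) = {𝔭₃, (2)}` — a row the mod-`ℓ` anisotropy method of parts X-X/X-Y cannot reach (the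
norm form on `ℤ[η]` is isotropic mod `2`; open cell (xvii′) of b03.23). Here `E ⊇ K = ℚ(√−3) = ℚ(ζ₃)`
(`√−3 = 1 + 2ζ₉³ = η³ + 3η = tη`, `t = σ + 3`, `σt² = −3` is `R(σ) = 0` itself) and `[F:ℚ] = 3` is odd, so for
`q ∈ ℚ^×`

  `[q] = [1]` in `F^×/Nm_{E/F}(E^×)`  ⟺  `q ∈ N_{K/ℚ}(K^×) = {x² + 3y² : x, y ∈ ℚ}`,

by the `K`-witness (part X-Z §2) and the explicit identity **`zeta9_cube_eq_sq_add_three_sq`** (`N₀³ = X² + 3Y²`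
modulo `N₁ = N₂ = 0`; `X + Y√−3 = z · g₄(z) · g₇(z)`, `gₖ : ζ₉ ↦ ζ₉ᵏ` the automorphisms of order `3`; found by computer
algebra, checked by `ring`). Consequences (Fermat's `x² + 3y²` theorem, tree
`QuadraticFields.BinaryQuadraticFormsPrimeRepresentation`; descent of part X-Z §3, at `ℓ = 2` through the anisotropic
form `u² + uv + v² = x² + 3y²`, `u = x + y`, `v = −2y`):

* `zeta9_mk_eq_split_iff`: `[q] = [(−1)²] ⟺ ∃ x y : ℚ, q = x² + 3y²`;
* `zeta9_mk_prime_mul_ne_split`: `[ℓw] ≠ [1]` for EVERY prime `ℓ ≡ 2 (mod 3)` and `ℓ ∤ w` — INCLUDING `ℓ = 2`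
  (the dyadic row: `zeta9_mk_two_ne_split`), `5, 11, 17 = 𝔭𝔭′𝔭″, 23, 29, 41, 47, 53, …`; `zeta9_rows_nonsplit`;
* `zeta9_mk_prime_eq_split`, **`zeta9_mk_prime_eq_split_iff`**: for a prime `ℓ`, `[ℓ] = [1] ⟺ ℓ = 3 ∨ ℓ ≡ 1 (mod 3)`
  — the COMPLETE prime classification of the table; `zeta9_rational_rows` (instance-free packaging).

THEOREMS ONLY: no `def`, no named fact, no `sorry`; `HC_CM` does not occur; nothing about the Hodge conjecture is
asserted (`[q] = [1]` says that `W12.ℚ(ζ₉).[q]` is the split component, Deligne Cor. 4.2, whose general member is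
OPEN like every row's).

## References
* [Deligne1982HodgeCycles] P. Deligne (notes by J. S. Milne), LNM 900 (1982), §4 p. 30 (1), Cor. 4.2, Lemma 4.6.
* [Cox2013] D. A. Cox, *Primes of the form x² + ny²*, 2nd ed., Wiley 2013, §1 (1.1) (Fermat, `x² + 3y²`).
* [Washington1997] L. C. Washington, *Introduction to Cyclotomic Fields*, GTM 83, Ch. 2 (`ℚ(ζ₃) ⊂ ℚ(ζ₉)`).
-/

noncomputable section

set_option linter.dupNamespace false

open Polynomial

namespace Summit.HodgeConjecture.HodgeConjecture.Ring2.WeilCoverageCM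

open Literature.AlgebraicGeometry.Deligne1982
open Literature.AlgebraicGeometry.HodgeTheory (splitDiscriminantClassCM)
open Literature.NumberTheory.QuadraticFields.Quadratic (legendreSym_neg_three_eq_one_iff
  exists_eq_sq_add_three_mul_sq_iff)

/-! ### §1 The pure identity `N₀³ ≡ X² + 3Y² (mod N₁, N₂)` -/

/-- **`N_{E/ℚ} = N_{K/ℚ} ∘ N_{E/K}` on `ℚ(ζ₉) ⊇ K = ℚ(√−3)`, as a polynomial identity.** For the coordinate norm
forms `N₀, N₁, N₂` of `R = S³ + 6S² + 9S + 3` (part X-Z `normForm_coords_of_realPolyQ_eq` at `(6, 9, 3)`): if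
`N₁ = N₂ = 0` then `N₀³ = X² + 3Y²` with the two integer cubic forms `X, Y` displayed (`X + Y√−3 = z·g₄z·g₇z`).
Checked by `linear_combination` with explicit quartic cofactors. [folklore] -/
theorem zeta9_cube_eq_sq_add_three_sq (a₀ a₁ a₂ b₀ b₁ b₂ : ℚ)
    (h1 : 2 * a₀ * a₁ - 18 * a₁ * a₂ + 51 * a₂ ^ 2 - b₀ ^ 2 + 18 * b₀ * b₂ + 9 * b₁ ^ 2 - 102 * b₁ * b₂ + 225 * b₂ ^ 2 = 0)
    (h2 : 2 * a₀ * a₂ + a₁ ^ 2 - 12 * a₁ * a₂ + 27 * a₂ ^ 2 - 2 * b₀ * b₁ + 12 * b₀ * b₂ + 6 * b₁ ^ 2 - 54 * b₁ * b₂ +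
        111 * b₂ ^ 2 = 0) :
    (a₀ ^ 2 - 6 * a₁ * a₂ + 18 * a₂ ^ 2 + 6 * b₀ * b₂ + 3 * b₁ ^ 2 - 36 * b₁ * b₂ + 81 * b₂ ^ 2) ^ 3
      = (a₀ ^ 3 - 6 * a₀ ^ 2 * a₁ + 18 * a₀ ^ 2 * a₂ + 9 * a₀ * a₁ ^ 2 - 45 * a₀ * a₁ * a₂ + 45 * a₀ * a₂ ^ 2 + 3 *
          a₀ * b₀ ^ 2 - 18 * a₀ * b₀ * b₁ + 63 * a₀ * b₀ * b₂ + 18 * a₀ * b₁ ^ 2 - 99 * a₀ * b₁ * b₂ + 108 * a₀ * b₂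
          ^ 2 - 3 * a₁ ^ 3 + 18 * a₁ ^ 2 * a₂ - 27 * a₁ * a₂ ^ 2 + 9 * a₁ * b₀ * b₁ - 45 * a₁ * b₀ * b₂ - 9 * a₁ *
          b₁ ^ 2 + 54 * a₁ * b₁ * b₂ - 54 * a₁ * b₂ ^ 2 + 9 * a₂ ^ 3 - 9 * a₂ * b₀ ^ 2 + 9 * a₂ * b₀ * b₁ + 27 * a₂
          * b₀ * b₂ - 27 * a₂ * b₁ * b₂ + 27 * a₂ * b₂ ^ 2) ^ 2
        + 3 * (3 * a₀ ^ 2 * b₁ - 15 * a₀ ^ 2 * b₂ - 3 * a₀ * a₁ * b₀ - 3 * a₀ * a₁ * b₁ + 27 * a₀ * a₁ * b₂ + 15 * a₀ *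
          a₂ * b₀ - 9 * a₀ * a₂ * b₁ - 18 * a₀ * a₂ * b₂ + 3 * a₁ ^ 2 * b₀ - 9 * a₁ ^ 2 * b₂ - 18 * a₁ * a₂ * b₀ + 9
          * a₁ * a₂ * b₁ + 9 * a₁ * a₂ * b₂ + 18 * a₂ ^ 2 * b₀ - 9 * a₂ ^ 2 * b₁ + b₀ ^ 3 - 6 * b₀ ^ 2 * b₁ + 18 *
          b₀ ^ 2 * b₂ + 9 * b₀ * b₁ ^ 2 - 45 * b₀ * b₁ * b₂ + 45 * b₀ * b₂ ^ 2 - 3 * b₁ ^ 3 + 18 * b₁ ^ 2 * b₂ - 27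
          * b₁ * b₂ ^ 2 + 9 * b₂ ^ 3) ^ 2 := by
  linear_combination (6 * a₀ ^ 4 - 18 * a₀ ^ 3 * a₁ + 90 * a₀ ^ 3 * a₂ + 57 * a₀ ^ 2 * a₁ ^ 2 - 522 * a₀ ^ 2 * a₁ * a₂ + 1080 * a₀ ^
      2 * a₂ ^ 2 + 9 * a₀ ^ 2 * b₀ ^ 2 - 90 * a₀ ^ 2 * b₀ * b₁ + 450 * a₀ ^ 2 * b₀ * b₂ + 225 * a₀ ^ 2 * b₁ ^ 2 -
      1944 * a₀ ^ 2 * b₁ * b₂ + 3942 * a₀ ^ 2 * b₂ ^ 2 - 36 * a₀ * a₁ ^ 3 + 432 * a₀ * a₁ ^ 2 * a₂ - 1872 * a₀ * a₁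
      * a₂ ^ 2 - 12 * a₀ * a₁ * b₀ ^ 2 + 72 * a₀ * a₁ * b₀ * b₁ - 324 * a₀ * a₁ * b₀ * b₂ - 162 * a₀ * a₁ * b₁ ^ 2 +
      1368 * a₀ * a₁ * b₁ * b₂ - 2754 * a₀ * a₁ * b₂ ^ 2 + 2700 * a₀ * a₂ ^ 3 + 36 * a₀ * a₂ * b₀ ^ 2 - 216 * a₀ *
      a₂ * b₀ * b₁ + 1188 * a₀ * a₂ * b₀ * b₂ + 594 * a₀ * a₂ * b₁ ^ 2 - 5400 * a₀ * a₂ * b₁ * b₂ + 11178 * a₀ * a₂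
      * b₂ ^ 2 + 27 * a₁ ^ 4 - 594 * a₁ ^ 3 * a₂ + 4806 * a₁ ^ 2 * a₂ ^ 2 + 18 * a₁ ^ 2 * b₀ ^ 2 - 108 * a₁ ^ 2 * b₀
      * b₁ + 594 * a₁ ^ 2 * b₀ * b₂ + 297 * a₁ ^ 2 * b₁ ^ 2 - 2700 * a₁ ^ 2 * b₁ * b₂ + 5589 * a₁ ^ 2 * b₂ ^ 2 -
      15876 * a₁ * a₂ ^ 3 - 162 * a₁ * a₂ * b₀ ^ 2 + 1188 * a₁ * a₂ * b₀ * b₁ - 6912 * a₁ * a₂ * b₀ * b₂ - 3456 * a₁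
      * a₂ * b₁ ^ 2 + 31752 * a₁ * a₂ * b₁ * b₂ - 65934 * a₁ * a₂ * b₂ ^ 2 + 18252 * a₂ ^ 4 + 342 * a₂ ^ 2 * b₀ ^ 2
      - 2700 * a₂ ^ 2 * b₀ * b₁ + 15876 * a₂ ^ 2 * b₀ * b₂ + 7938 * a₂ ^ 2 * b₁ ^ 2 - 73008 * a₂ ^ 2 * b₁ * b₂ +
      151632 * a₂ ^ 2 * b₂ ^ 2 + 3 * b₀ ^ 4 - 36 * b₀ ^ 3 * b₁ + 162 * b₀ ^ 3 * b₂ + 189 * b₀ ^ 2 * b₁ ^ 2 - 1872 *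
      b₀ ^ 2 * b₁ * b₂ + 4833 * b₀ ^ 2 * b₂ ^ 2 - 594 * b₀ * b₁ ^ 3 + 8856 * b₀ * b₁ ^ 2 * b₂ - 42930 * b₀ * b₁ * b₂
      ^ 2 + 65934 * b₀ * b₂ ^ 3 + 864 * b₁ ^ 4 - 15876 * b₁ ^ 3 * b₂ + 105975 * b₁ ^ 2 * b₂ ^ 2 - 303264 * b₁ * b₂ ^
      3 + 314928 * b₂ ^ 4) * h1
    + (-18 * a₀ ^ 4 - 90 * a₀ ^ 3 * a₂ - 45 * a₀ ^ 2 * a₁ ^ 2 + 756 * a₀ ^ 2 * a₁ * a₂ - 1899 * a₀ ^ 2 * a₂ ^ 2 + 90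
      * a₀ ^ 2 * b₀ * b₁ - 756 * a₀ ^ 2 * b₀ * b₂ - 378 * a₀ ^ 2 * b₁ ^ 2 + 3726 * a₀ ^ 2 * b₁ * b₂ - 7911 * a₀ ^ 2
      * b₂ ^ 2 - 36 * a₀ * a₁ ^ 2 * a₂ + 972 * a₀ * a₁ * a₂ ^ 2 - 2592 * a₀ * a₂ ^ 3 + 72 * a₀ * a₂ * b₀ * b₁ - 972
      * a₀ * a₂ * b₀ * b₂ - 486 * a₀ * a₂ * b₁ ^ 2 + 5184 * a₀ * a₂ * b₁ * b₂ - 11286 * a₀ * a₂ * b₂ ^ 2 - 9 * a₁ ^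
      4 + 486 * a₁ ^ 3 * a₂ - 6480 * a₁ ^ 2 * a₂ ^ 2 + 36 * a₁ ^ 2 * b₀ * b₁ - 486 * a₁ ^ 2 * b₀ * b₂ - 243 * a₁ ^ 2
      * b₁ ^ 2 + 2592 * a₁ ^ 2 * b₁ * b₂ - 5643 * a₁ ^ 2 * b₂ ^ 2 + 26730 * a₁ * a₂ ^ 3 - 972 * a₁ * a₂ * b₀ * b₁ +
      10368 * a₁ * a₂ * b₀ * b₂ + 5184 * a₁ * a₂ * b₁ ^ 2 - 53460 * a₁ * a₂ * b₁ * b₂ + 115182 * a₁ * a₂ * b₂ ^ 2 -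
      34263 * a₂ ^ 4 + 2592 * a₂ ^ 2 * b₀ * b₁ - 26730 * a₂ ^ 2 * b₀ * b₂ - 13365 * a₂ ^ 2 * b₁ ^ 2 + 137052 * a₂ ^
      2 * b₁ * b₂ - 294759 * a₂ ^ 2 * b₂ ^ 2 - 36 * b₀ ^ 2 * b₁ ^ 2 + 972 * b₀ ^ 2 * b₁ * b₂ - 5184 * b₀ ^ 2 * b₂ ^
      2 + 486 * b₀ * b₁ ^ 3 - 10368 * b₀ * b₁ ^ 2 * b₂ + 64746 * b₀ * b₁ * b₂ ^ 2 - 115182 * b₀ * b₂ ^ 3 - 1296 * b₁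
      ^ 4 + 26730 * b₁ ^ 3 * b₂ - 194643 * b₁ ^ 2 * b₂ ^ 2 + 589518 * b₁ * b₂ ^ 3 - 633582 * b₂ ^ 4) * h2

/-! ### §2 The carrier `R = S³ + 6S² + 9S + 3`: `√−3 ∈ E` and the rational rows -/

section Zeta9

variable {R : Polynomial ℤ}

/-- `realPolyQ R = S³ + 6S² + 9S + 3` with `C`-coefficients (part X-U `realPolyQ_eq_of_cubic`).
[cite: Deligne1982HodgeCycles, §4 p. 30] -/
theorem zeta9_realPolyQ_C (hR : R = X ^ 3 + C 6 * X ^ 2 + C 9 * X + C 3) :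
    realPolyQ R = X ^ 3 + C (6 : ℚ) * X ^ 2 + C (9 : ℚ) * X + C (3 : ℚ) := by
  have h := realPolyQ_eq_of_cubic R hR
  push_cast at h
  exact h

variable [Fact (Irreducible (realPolyQ R))]

/-- **`√−3 ∈ ℚ(ζ₉)`**: `t = σ + 3 ∈ F` has `σt² = −3` — this is `R(σ) = σ³ + 6σ² + 9σ + 3 = 0` itself —, i.e.
`s = tη = η³ + 3η` satisfies `s² = −3` (`s = 1 + 2ζ₉³ = 1 + 2ζ₃`). [cite: Washington1997, Ch. 2] -/
theorem zeta9_root_mul_sq_eq_neg_three (hR : R = X ^ 3 + C 6 * X ^ 2 + C 9 * X + C 3) :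
    AdjoinRoot.root (realPolyQ R) * (AdjoinRoot.root (realPolyQ R) + 3) ^ 2 = AdjoinRoot.of (realPolyQ R) (-3) := by
  have hσ := root_rel_of_realPolyQ_eq (zeta9_realPolyQ_C hR)
  simp only [map_ofNat] at hσ
  rw [map_neg, map_ofNat]
  linear_combination hσ

variable [Fact (Irreducible (cmPolyQ R))]

/-- **«⟸»: `[x² + 3y²] = [(−1)²] = [1]`** in `ℚ(ζ₉)⁺^×/Nm ℚ(ζ₉)^×` for all `x, y ∈ ℚ` (`x² + 3y² =
Nm_{E/F}(x + y√−3)`; part X-Z §2). [cite: Deligne1982HodgeCycles, §4 p. 30 (1) and Cor. 4.2 (a)] -/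
theorem zeta9_mk_eq_split_of_sq_add_three_sq (hR : R = X ^ 3 + C 6 * X ^ 2 + C 9 * X + C 3) (x y : ℚ)
    (q : (realField R)ˣ) (hq : (q : realField R) = AdjoinRoot.of (realPolyQ R) (x ^ 2 + 3 * y ^ 2)) :
    (QuotientGroup.mk q : cmNormResidueGroup R) = splitDiscriminantClassCM R 2 :=
  mk_eq_splitDiscriminantClassCM_two_of_sq_add_mul_sq _ (zeta9_root_mul_sq_eq_neg_three hR) x y q hq

/-- **«⟹»: `[q] = [1]`, `q ∈ ℚ^×` ⟹ `q = x² + 3y²` with `x, y ∈ ℚ`.** `q = A² − σB² = Nm_{E/F}(A + Bη)`; in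
coordinates `N₀ = q`, `N₁ = N₂ = 0` (part X-Z), so `q³ = X² + 3Y²` (`zeta9_cube_eq_sq_add_three_sq`) and
`q = (X/q)² + 3(Y/q)²`. [cite: Deligne1982HodgeCycles, §4 p. 30 (1) and Cor. 4.2 (a)] -/
theorem zeta9_exists_sq_add_three_sq_of_mk_eq_split (hR : R = X ^ 3 + C 6 * X ^ 2 + C 9 * X + C 3) {c : ℚ}
    (q : (realField R)ˣ) (hq : (q : realField R) = AdjoinRoot.of (realPolyQ R) c)
    (h : (QuotientGroup.mk q : cmNormResidueGroup R) = splitDiscriminantClassCM R 2) :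
    ∃ x y : ℚ, c = x ^ 2 + 3 * y ^ 2 := by
  have hRQ := zeta9_realPolyQ_C hR
  have hmonic : (realPolyQ R).Monic := by rw [hRQ]; monicity!
  have hdeg : (realPolyQ R).natDegree = 3 := by rw [hRQ]; compute_degree!
  have hc0 : c ≠ 0 := by
    rintro rfl
    rw [map_zero] at hq
    exact q.ne_zero hq
  rw [splitDiscriminantClassCM, neg_one_sq] at h
  obtain ⟨z, -, hz⟩ := exists_eq_ratCast_mul_norm_of_mk_eq (q := q) (u := 1) (c := 1)
    (by rw [Units.val_one, Rat.cast_one]) h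
  rw [Rat.cast_one, one_mul] at hz
  obtain ⟨A, B, rfl⟩ := exists_eq_realToCM_add_mul_cmRoot R z
  rw [norm_coords, algebraMap_realField_eq, hq] at hz
  have hz' := ((realToCM R).injective hz).symm
  obtain ⟨a₀, a₁, a₂, rfl⟩ := exists_coords_of_natDegree_eq_three hmonic hdeg A
  obtain ⟨b₀, b₁, b₂, rfl⟩ := exists_coords_of_natDegree_eq_three hmonic hdeg B
  obtain ⟨h0, h1, h2⟩ := coords_of_normForm_eq_of hRQ hz'
  have h1' : 2 * a₀ * a₁ - 18 * a₁ * a₂ + 51 * a₂ ^ 2 - b₀ ^ 2 + 18 * b₀ * b₂ + 9 * b₁ ^ 2 - 102 * b₁ * b₂ + 225 * b₂ ^ 2 = 0 := by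
    linear_combination h1
  have h2' : 2 * a₀ * a₂ + a₁ ^ 2 - 12 * a₁ * a₂ + 27 * a₂ ^ 2 - 2 * b₀ * b₁ + 12 * b₀ * b₂ + 6 * b₁ ^ 2 - 54 * b₁ * b₂ +
        111 * b₂ ^ 2 = 0 := by
    linear_combination h2
  have h0' : a₀ ^ 2 - 6 * a₁ * a₂ + 18 * a₂ ^ 2 + 6 * b₀ * b₂ + 3 * b₁ ^ 2 - 36 * b₁ * b₂ + 81 * b₂ ^ 2 = c := by
    linear_combination h0
  obtain ⟨X, Y, hXY⟩ : ∃ X Y : ℚ, (a₀ ^ 2 - 6 * a₁ * a₂ + 18 * a₂ ^ 2 + 6 * b₀ * b₂ + 3 * b₁ ^ 2 - 36 * b₁ * b₂ + 81 * b₂ ^ 2) ^ 3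
      = X ^ 2 + 3 * Y ^ 2 :=
    ⟨_, _, zeta9_cube_eq_sq_add_three_sq a₀ a₁ a₂ b₀ b₁ b₂ h1' h2'⟩
  rw [h0'] at hXY
  refine ⟨X / c, Y / c, ?_⟩
  symm
  calc (X / c) ^ 2 + 3 * (Y / c) ^ 2 = (X ^ 2 + 3 * Y ^ 2) / c ^ 2 := by ring
    _ = c ^ 3 / c ^ 2 := by rw [hXY]
    _ = c := (div_eq_iff (pow_ne_zero 2 hc0)).mpr (by ring)

/-- **The rational rows of the `ℚ(ζ₉)` table in closed form: `[q] = [(−1)²] = [1] ⟺ q = x² + 3y²` for some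
`x, y ∈ ℚ`** (`q ∈ ℚ^×`; i.e. `q ∈ Nm_{E/F}(E^×) ⟺ q ∈ N_{K/ℚ}(K^×)`, `K = ℚ(√−3)`). For the census: the component
`W12.ℚ(ζ₉).[q]` is the split one iff `q` is a norm from `ℚ(ζ₃)`. [cite: Deligne1982HodgeCycles, §4 p. 30 (1) and Cor. 4.2] -/
theorem zeta9_mk_eq_split_iff (hR : R = X ^ 3 + C 6 * X ^ 2 + C 9 * X + C 3) {c : ℚ} (q : (realField R)ˣ)
    (hq : (q : realField R) = AdjoinRoot.of (realPolyQ R) c) :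
    (QuotientGroup.mk q : cmNormResidueGroup R) = splitDiscriminantClassCM R 2 ↔ ∃ x y : ℚ, c = x ^ 2 + 3 * y ^ 2 :=
  ⟨zeta9_exists_sq_add_three_sq_of_mk_eq_split hR q hq, fun ⟨x, y, hc⟩ =>
    zeta9_mk_eq_split_of_sq_add_three_sq hR x y q (by rw [hq, hc])⟩

/-- **Which rationals label the SAME row: `[q₁] = [q₂] ⟺ q₁q₂ = x² + 3y²` for some `x, y ∈ ℚ`** — the
rational classes of `F^×/Nm_{E/F}(E^×)` form the group `ℚ^×/N_{K/ℚ}(K^×)`, `K = ℚ(ζ₃)` (`[q₁] = [q₂] ⟺ q₁⁻¹q₂ ∈ Nm ⟺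
q₁q₂ = (q₁⁻¹q₂)·q₁² ∈ Nm`, squares being norms, part III `sq_mem_normUnitsSubgroup_cmField`).
[cite: Deligne1982HodgeCycles, §4 p. 30 (1) and Cor. 4.2] -/
theorem zeta9_mk_eq_mk_iff (hR : R = X ^ 3 + C 6 * X ^ 2 + C 9 * X + C 3) {c₁ c₂ : ℚ} (q₁ q₂ : (realField R)ˣ)
    (hq₁ : (q₁ : realField R) = AdjoinRoot.of (realPolyQ R) c₁) (hq₂ : (q₂ : realField R) = AdjoinRoot.of (realPolyQ R) c₂) :
    (QuotientGroup.mk q₁ : cmNormResidueGroup R) = QuotientGroup.mk q₂ ↔ ∃ x y : ℚ, c₁ * c₂ = x ^ 2 + 3 * y ^ 2 := by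
  rw [← zeta9_mk_eq_split_iff hR (q₁ * q₂) (by rw [Units.val_mul, hq₁, hq₂, map_mul]),
    splitDiscriminantClassCM_two_eq_one, QuotientGroup.eq, QuotientGroup.eq_one_iff]
  have hsq := sq_mem_normUnitsSubgroup_cmField (R := R) q₁
  have e : q₁ * q₂ = q₁⁻¹ * q₂ * q₁ ^ 2 := by
    rw [sq, mul_comm q₁⁻¹ q₂, mul_assoc, inv_mul_cancel_left, mul_comm]
  constructor
  · intro h
    rw [e]
    exact mul_mem h hsq
  · intro h
    have e' : q₁⁻¹ * q₂ = q₁ * q₂ * (q₁ ^ 2)⁻¹ := by rw [e, mul_inv_cancel_right]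
    rw [e']
    exact mul_mem h (inv_mem hsq)

/-! ### §3 The class of every prime (the dyadic row included) -/

/-- **`[ℓw] ≠ [1]` for every prime `ℓ ≡ 2 (mod 3)` and `ℓ ∤ w`** — the primes INERT in `ℚ(√−3)`, INCLUDING `ℓ = 2`:
`ℓw = x² + 3y²` has no rational solution (part X-Z `prime_mul_ne_binaryForm`: for odd `ℓ`, `x² + 3y²` is anisotropic
mod `ℓ` as `(−3/ℓ) = −1`; for `ℓ = 2`, `x² + 3y² = u² + uv + v²` with `u = x + y`, `v = −2y`, anisotropic mod `2`).
For the census: the rows `W12.ℚ(ζ₉).[ℓw]` are NON-SPLIT (no `E`-Lagrangian member, Deligne Cor. 4.2); `ℓ = 2`,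
`w = 1` is the tabulated row `[2]`, `T(2) = {𝔭₃, (2)}`. [cite: Deligne1982HodgeCycles, §4 p. 30 (1) and Cor. 4.2]
[cite: Cox2013, §1 (1.1)] -/
theorem zeta9_mk_prime_mul_ne_split (hR : R = X ^ 3 + C 6 * X ^ 2 + C 9 * X + C 3) {ℓ : ℕ} (hℓ : ℓ.Prime)
    (h3 : ℓ % 3 = 2) (w : ℤ) (hw : ¬ (ℓ : ℤ) ∣ w) (q : (realField R)ˣ)
    (hq : (q : realField R) = AdjoinRoot.of (realPolyQ R) ((ℓ : ℚ) * w)) :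
    (QuotientGroup.mk q : cmNormResidueGroup R) ≠ splitDiscriminantClassCM R 2 := by
  intro h
  obtain ⟨x, y, hxy⟩ := zeta9_exists_sq_add_three_sq_of_mk_eq_split hR q hq h
  by_cases hℓ2 : ℓ = 2
  · subst hℓ2
    exact prime_mul_ne_binaryForm Nat.prime_two 1 1 aniso_two_sq_add_mul_add_sq w hw (x + y) (-2 * y)
      (by push_cast; linear_combination hxy)
  · haveI := Fact.mk hℓ
    have hℓ3 : ℓ ≠ 3 := by omega
    have h0 : ((-3 : ℤ) : ZMod ℓ) ≠ 0 := by
      intro h0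
      rw [Int.cast_neg, neg_eq_zero, ZMod.intCast_zmod_eq_zero_iff_dvd] at h0
      exact hℓ3 ((Nat.prime_dvd_prime_iff_eq hℓ (by norm_num)).1 (by exact_mod_cast h0))
    have hns : ¬ IsSquare ((-3 : ℤ) : ZMod ℓ) := by
      rw [← legendreSym.eq_neg_one_iff (p := ℓ)]
      rcases legendreSym.eq_one_or_neg_one ℓ h0 with h1 | h1
      · rw [legendreSym_neg_three_eq_one_iff hℓ2 hℓ3] at h1
        omega
      · exact h1
    exact prime_mul_ne_binaryForm hℓ 0 3 (aniso_sq_add_mul_sq_of_not_isSquare 3 hns) w hw x y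
      (by push_cast; linear_combination hxy)

/-- **The dyadic row `[2] ≠ [1]` of the `ℚ(ζ₉)` table** (`T(2) = {𝔭₃, (2)}` in the certified computation kit j209882;
open cell (xvii′) of census b03.23): `2` is not a norm from `ℚ(ζ₉)` to `ℚ(ζ₉)⁺`. [cite: Deligne1982HodgeCycles, §4 p. 30 (1) and Cor. 4.2] -/
theorem zeta9_mk_two_ne_split (hR : R = X ^ 3 + C 6 * X ^ 2 + C 9 * X + C 3) (q : (realField R)ˣ)
    (hq : (q : realField R) = 2) :
    (QuotientGroup.mk q : cmNormResidueGroup R) ≠ splitDiscriminantClassCM R 2 :=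
  zeta9_mk_prime_mul_ne_split hR Nat.prime_two (by norm_num) 1 (by norm_num) q (by rw [hq]; norm_num)

/-- The rational rows `2, 5, 11, 17, 34` of the census table of `ℚ(ζ₉)` (the classes `[2]`, `[17]`, `[34]` are the three
non-trivial rational classes supported on `S6 = {𝔭₃, (2), 𝔭₁₇, 𝔭₁₇′, 𝔭₁₇″, 𝔭₅₃}`, kit j209882) are NON-SPLIT in the
kernel: instances `(ℓ, w) = (2,1), (5,1), (11,1), (17,1), (17,2)` of `zeta9_mk_prime_mul_ne_split`.
[cite: Deligne1982HodgeCycles, §4 p. 30 (1) and Cor. 4.2] -/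
theorem zeta9_rows_nonsplit (hR : R = X ^ 3 + C 6 * X ^ 2 + C 9 * X + C 3) {n : ℕ}
    (hn : n = 2 ∨ n = 5 ∨ n = 11 ∨ n = 17 ∨ n = 34) (q : (realField R)ˣ)
    (hq : (q : realField R) = AdjoinRoot.of (realPolyQ R) n) :
    (QuotientGroup.mk q : cmNormResidueGroup R) ≠ splitDiscriminantClassCM R 2 := by
  rcases hn with rfl | rfl | rfl | rfl | rfl
  · exact zeta9_mk_prime_mul_ne_split hR (ℓ := 2) (by norm_num) (by norm_num) 1 (by norm_num) q
      (by rw [hq]; norm_num)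
  · exact zeta9_mk_prime_mul_ne_split hR (ℓ := 5) (by norm_num) (by norm_num) 1 (by norm_num) q
      (by rw [hq]; norm_num)
  · exact zeta9_mk_prime_mul_ne_split hR (ℓ := 11) (by norm_num) (by norm_num) 1 (by norm_num) q
      (by rw [hq]; norm_num)
  · exact zeta9_mk_prime_mul_ne_split hR (ℓ := 17) (by norm_num) (by norm_num) 1 (by norm_num) q
      (by rw [hq]; norm_num)
  · exact zeta9_mk_prime_mul_ne_split hR (ℓ := 17) (by norm_num) (by norm_num) 2 (by norm_num) q
      (by rw [hq]; norm_num)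

/-- **`[ℓ] = [1]` for `ℓ = 3` and every prime `ℓ ≡ 1 (mod 3)`** — the primes ramified or split in `ℚ(√−3)`:
`3 = 0² + 3·1²`, and a prime `ℓ ≡ 1 (mod 3)` is `x² + 3y²` with `x, y ∈ ℤ` (Fermat; tree
`exists_eq_sq_add_three_mul_sq_iff`). For the census: these rows `W12.ℚ(ζ₉).[ℓ]` ARE the split component
(`[3] = [1]` as tabulated). [cite: Cox2013, §1 (1.1)] [cite: Deligne1982HodgeCycles, §4 Cor. 4.2] -/
theorem zeta9_mk_prime_eq_split (hR : R = X ^ 3 + C 6 * X ^ 2 + C 9 * X + C 3) {ℓ : ℕ} (hℓ : ℓ.Prime)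
    (h3 : ℓ = 3 ∨ ℓ % 3 = 1) (q : (realField R)ˣ)
    (hq : (q : realField R) = AdjoinRoot.of (realPolyQ R) (ℓ : ℚ)) :
    (QuotientGroup.mk q : cmNormResidueGroup R) = splitDiscriminantClassCM R 2 := by
  have hℓ2 : ℓ ≠ 2 := by omega
  obtain ⟨x, y, hxy⟩ := (exists_eq_sq_add_three_mul_sq_iff hℓ hℓ2).2 h3
  exact zeta9_mk_eq_split_of_sq_add_three_sq hR x y q (by rw [hq]; congr 1; exact_mod_cast hxy)

/-- **The class of every prime in the `ℚ(ζ₉)` table: `[ℓ] = [1] ⟺ ℓ = 3 ∨ ℓ ≡ 1 (mod 3)`** (⟺ `ℓ` is not inert in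
`ℚ(√−3) ⊂ ℚ(ζ₉)`). In the census table (kit j209882): `[3] = [1]`; `[2]`, `[17]`, `[53]` non-split — all
instances. [cite: Deligne1982HodgeCycles, §4 p. 30 (1) and Cor. 4.2] [cite: Cox2013, §1 (1.1)] -/
theorem zeta9_mk_prime_eq_split_iff (hR : R = X ^ 3 + C 6 * X ^ 2 + C 9 * X + C 3) {ℓ : ℕ} (hℓ : ℓ.Prime)
    (q : (realField R)ˣ) (hq : (q : realField R) = AdjoinRoot.of (realPolyQ R) (ℓ : ℚ)) :
    (QuotientGroup.mk q : cmNormResidueGroup R) = splitDiscriminantClassCM R 2 ↔ (ℓ = 3 ∨ ℓ % 3 = 1) := by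
  refine ⟨fun h => ?_, fun h3 => zeta9_mk_prime_eq_split hR hℓ h3 q hq⟩
  by_contra h3
  have h3' : ℓ % 3 = 2 := by
    have h30 : ℓ % 3 ≠ 0 := fun h0 => by
      rcases (Nat.dvd_prime hℓ).1 (Nat.dvd_of_mod_eq_zero h0) with h' | h' <;> omega
    omega
  have hw : ¬ ((ℓ : ℤ) ∣ 1) := fun hd =>
    hℓ.one_lt.ne' (by exact_mod_cast Int.eq_one_of_dvd_one (by positivity) hd)
  exact zeta9_mk_prime_mul_ne_split hR hℓ h3' 1 hw q (by rw [hq, Int.cast_one, mul_one]) h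

end Zeta9

/-! ### §4 Instance-free packaging on the literal carrier -/

/-- **The rational rows of `W12.ℚ(ζ₉)` (census b03.24), unconditionally**: on the literal carrier
`R = S³ + 6S² + 9S + 3` (field instances from parts X-V `zeta9_fact_realPolyQ` / `zeta9_fact_cmPolyQ`), for every
`q ∈ ℚ^×`: `[q] = [(−1)²] ⟺ ∃ x y ∈ ℚ, q = x² + 3y²`. [cite: Deligne1982HodgeCycles, §4 p. 30 (1) and Cor. 4.2] -/
theorem zeta9_rational_rows :
    haveI := zeta9_fact_realPolyQ
    ∀ (c : ℚ) (q : (realField (X ^ 3 + C 6 * X ^ 2 + C 9 * X + C 3 : Polynomial ℤ))ˣ),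
      (q : realField (X ^ 3 + C 6 * X ^ 2 + C 9 * X + C 3 : Polynomial ℤ)) = AdjoinRoot.of _ c →
      ((QuotientGroup.mk q : cmNormResidueGroup (X ^ 3 + C 6 * X ^ 2 + C 9 * X + C 3 : Polynomial ℤ)) =
          splitDiscriminantClassCM (X ^ 3 + C 6 * X ^ 2 + C 9 * X + C 3 : Polynomial ℤ) 2 ↔
        ∃ x y : ℚ, c = x ^ 2 + 3 * y ^ 2) := by
  haveI := zeta9_fact_realPolyQ
  haveI := zeta9_fact_cmPolyQ
  exact fun c q hq => zeta9_mk_eq_split_iff rfl q hq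

end Summit.HodgeConjecture.HodgeConjecture.Ring2.WeilCoverageCM

end
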